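import Summits.CriticalPhenomena.CardyFormulaZ2.Theorems.CardyIKTransportIKMixedBoxCrossingDefectGlueDefs
import Summits.CriticalPhenomena.CardyFormulaZ2.Theorems.CardyIKTransportIKMixedBoxCrossingDefectStubCondBox
import Literature.Probability.Percolation.DualContours

/-!
# Stub `stub_bridgeLaw` of the line `defect-closure-exploration` (crux `IKMixedBoxCrossing`, stmt-CriticalPhenomena-5911)

Gauge bits `ω = (A, B, Pb, Pf, C)`, product law `μIK`. On the `(m+1) × (n+1)` box at the origin the cell `(x, y)` is black iff
`A x ⊕ B y ⊕ R(x, y)`, `R(x, y)` the plaquette parity of `[0, x) × [0, y)` (`mem_blackSet_iff`); TELESCOPING (`odd_rectCount_succ_succ`)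
gives the plaquette bit of the inner face `(i, j)` as `R(i+1,j+1) ⊕ R(i,j+1) ⊕ R(i+1,j) ⊕ R(i,j)`, i.e. the face parity
`fpar c (i, j)` on `{colours = c}`, where also `A x = c(x,0) ⊕ B 0`, `B y = c(0,y) ⊕ c(0,0) ⊕ B 0` (`readout`); a colouring is
determined by first row, first column and face parities (`eq_of_fpar_eq`). So `{colours = c, coins = κ}` is the disjoint union over
`g = B 0` of two PRODUCT cylinders of the five Bernoulli fields (`preimage_gaugeBox`), each of mass `const · wt S c`,
`wt S c = ∏_{inner S-faces} t^[fpar]` (`real_cyl`, using `p = 2√3 − 3 = (1 − p)·t`). FREE SIDE: the atom of `colourLaw ⊗ coinMeasure ½`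
at `(c, κ)` is `Z⁻¹ t^{#odd S-faces} 2^{-(m+1)(n+1)} = const · wt S c` (`colourLaw_atom`, `coin_atom`, `pow_oddFaceCount`). Probability
measures on a finite type with proportional atoms are equal (`measure_eq_of_proportional`); `W = 0` or `H = 0`: one-point types.
-/
noncomputable section

namespace Summit.CriticalPhenomena.CardyFormulaZ2.Cruxes.IKMixedBoxCrossing.DefectClosureExploration

open scoped Classical BigOperators NNReal ENNReal
open MeasureTheory ProbabilityTheory
open Literature.Probability.Percolation Literature.Probability.LatticeModels
open Summit.CriticalPhenomena.CardyFormulaZ2.Theorems.IKLinearTransport.PinnedDiagramExchange (Ω μIK blackSet parSet sum_Ico_minmax_chasles)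
open Summit.CriticalPhenomena.CardyFormulaZ2.Theorems.IKLinearTransport.PinnedDiagramExchange.CouplingToLimits
  (measurable_mem_blackSet isProbabilityMeasure_μIK)
open Summit.CriticalPhenomena.CardyFormulaZ2.Theorems.IKMixedBoxCrossing.Negative (pDef coe_pDef)

namespace BridgeLawStub

variable {m n : ℕ}

/-- The site of `ℤ²` with natural coordinates `q`. -/
def site {k l : ℕ} (q : Fin k × Fin l) : Site 2 := ![((q.1 : ℕ) : ℤ), ((q.2 : ℕ) : ℤ)]

/-- First coordinate of `site q`. -/
@[simp] theorem site_apply_zero {k l : ℕ} (q : Fin k × Fin l) : site q 0 = ((q.1 : ℕ) : ℤ) := rfl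

/-- Second coordinate of `site q`. -/
@[simp] theorem site_apply_one {k l : ℕ} (q : Fin k × Fin l) : site q 1 = ((q.2 : ℕ) : ℤ) := rfl

/-- `site` is injective. -/
theorem site_injective {k l : ℕ} : Function.Injective (site : Fin k × Fin l → Site 2) := fun q q' h =>
  Prod.ext (Fin.ext (Nat.cast_injective ((site_apply_zero q).symm.trans ((congrFun h 0).trans (site_apply_zero q')))))
    (Fin.ext (Nat.cast_injective ((site_apply_one q).symm.trans ((congrFun h 1).trans (site_apply_one q')))))

/-- Membership in the cell rectangle at the origin. -/
theorem mem_cellRect_iff {k l : ℕ} {v : Site 2} : v ∈ cellRect 0 0 k l ↔ 0 ≤ v 0 ∧ v 0 < k ∧ 0 ≤ v 1 ∧ v 1 < l := by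
  simp only [cellRect, Finset.mem_image, Finset.mem_product, Finset.mem_Ico, zero_add]
  exact ⟨fun ⟨p, ⟨⟨h1, h2⟩, h3, h4⟩, hp⟩ => hp ▸ ⟨h1, h2, h3, h4⟩,
    fun ⟨h1, h2, h3, h4⟩ => ⟨(v 0, v 1), ⟨⟨h1, h2⟩, h3, h4⟩, Contour.site_ext rfl rfl⟩⟩

/-- Sites with `Fin` coordinates lie in the rectangle. -/
theorem site_mem_cellRect {k l : ℕ} (q : Fin k × Fin l) : site q ∈ cellRect 0 0 k l := mem_cellRect_iff.2 ⟨by simp, by simp, by simp, by simp⟩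

/-- A site of the quadrant with coordinates below `k`, `l` has `Fin` coordinates. -/
theorem exists_site_eq {k l : ℕ} {v : Site 2} (h0 : 0 ≤ v 0) (hk : v 0 < k) (h1 : 0 ≤ v 1) (hl : v 1 < l) : ∃ q : Fin k × Fin l, site q = v :=
  ⟨(⟨(v 0).toNat, by omega⟩, ⟨(v 1).toNat, by omega⟩), Contour.site_ext (by simp [Int.toNat_of_nonneg h0]) (by simp [Int.toNat_of_nonneg h1])⟩

/-- The inner faces of the `(m+1) × (n+1)` rectangle are the sites with coordinates in `Fin m × Fin n`. -/
theorem mem_innerVertices_iff_site {v : Site 2} : v ∈ innerVertices (cellRect 0 0 (m + 1) (n + 1)) ↔ ∃ q : Fin m × Fin n, site q = v := by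
  have h10 : (1 : Fin 2) ≠ 0 := by decide
  have h01 : (0 : Fin 2) ≠ 1 := by decide
  rw [mem_innerVertices_iff, cellFace, Finset.insert_subset_iff, Finset.insert_subset_iff, Finset.insert_subset_iff, Finset.singleton_subset_iff]
  simp only [mem_cellRect_iff, Pi.add_apply, Pi.one_apply, Pi.single_eq_same, Pi.single_eq_of_ne h10, Pi.single_eq_of_ne h01, add_zero,
    Nat.cast_add, Nat.cast_one]
  constructor
  · rintro ⟨⟨h0, -, h1, -⟩, ⟨-, hm, -, -⟩, ⟨-, -, -, hn⟩, -⟩; exact exists_site_eq h0 (by omega) h1 (by omega)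
  · rintro ⟨q, rfl⟩; have := q.1.is_lt; have := q.2.is_lt; simp only [site_apply_zero, site_apply_one]; omega

/-- Colourings (or coin assignments) of the `(m+1) × (n+1)` box. -/
abbrev Col (m n : ℕ) : Type := Fin (m + 1) × Fin (n + 1) → Bool

/-- Parity of the colouring `c` at the inner face `q`. -/
def fpar (c : Col m n) (q : Fin m × Fin n) : Bool :=
  (c (q.1.castSucc, q.2.castSucc) ^^ c (q.1.succ, q.2.castSucc)) ^^ (c (q.1.castSucc, q.2.succ) ^^ c (q.1.succ, q.2.succ))

/-- A colouring is determined by its first row, its first column and its inner face parities. -/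
theorem eq_of_fpar_eq {c c' : Col m n} (h0 : ∀ x, c (x, 0) = c' (x, 0)) (h1 : ∀ y, c (0, y) = c' (0, y)) (h : ∀ q, fpar c q = fpar c' q) : c = c' := by
  have key : ∀ (y : Fin (n + 1)) (x : Fin (m + 1)), c (x, y) = c' (x, y) := by
    intro y
    induction y using Fin.induction with
    | zero => exact h0
    | succ j ih =>
      intro x
      induction x using Fin.induction with
      | zero => exact h1 _
      | succ i ih' =>
        have hq := h (i, j)
        simp only [fpar] at hq
        rw [ih i.castSucc, ih i.succ, ih'] at hq
        revert hq
        cases c' (i.castSucc, j.castSucc) <;> cases c' (i.succ, j.castSucc) <;> cases c' (i.castSucc, j.succ) <;> cases c (i.succ, j.succ) <;>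
          cases c' (i.succ, j.succ) <;> decide
  exact funext fun q => key q.2 q.1

/-- The common weight of the two laws: `t ^ #{odd inner S-faces}`. -/
def wt (S : Set ℤ) (c : Col m n) : ℝ := ∏ q : Fin m × Fin n, if ((q.1 : ℕ) : ℤ) ∈ S ∧ fpar c q = true then ((tIK : ℝ≥0) : ℝ) else 1

/-- Number of marked plaquettes of the anchored rectangle of `(a, b)` (its parity enters the colour of `(a, b)`). -/
def rectCount (S : Set ℤ) (ω : Ω) (a b : ℤ) : ℕ :=
  ((Finset.Ico (min 0 a) (max 0 a) ×ˢ Finset.Ico (min 0 b) (max 0 b)).filter (fun f : ℤ × ℤ => (![f.1, f.2] : Site 2) ∈ parSet S ω)).card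

/-- The colour of a cell: column sign ⊕ row sign ⊕ anchored parity. -/
theorem mem_blackSet_iff (S : Set ℤ) (ω : Ω) (a b : ℤ) :
    (![a, b] : Site 2) ∈ blackSet S ω ↔ Xor (a ∈ ω.1) (Xor (b ∈ ω.2.1) (Odd (rectCount S ω a b))) := by
  simp only [blackSet, Set.mem_setOf_eq, Matrix.cons_val_zero, Matrix.cons_val_one, rectCount]

/-- TELESCOPING: the plaquette bit of the face `(a, b)` is the alternating sum of the four anchored parities around it. -/
theorem odd_rectCount_succ_succ (S : Set ℤ) (ω : Ω) (a b : ℤ) : Odd (rectCount S ω (a + 1) (b + 1)) ↔ Xor (Xor (Odd (rectCount S ω a (b + 1)))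
    (Odd (rectCount S ω (a + 1) b))) (Xor (Odd (rectCount S ω a b)) ((![a, b] : Site 2) ∈ parSet S ω)) := by
  have key : ∀ (u v w : ZMod 2) (P : Prop), (u + (w + if P then 1 else 0) = 1 ↔ Xor (Xor (u = 1) (v + w = 1)) (Xor (v = 1) P)) := by
    intro u v w P; by_cases hP : P
    · rw [if_pos hP]; simp only [hP]; revert u v w; decide
    · rw [if_neg hP, add_zero]; simp only [hP]; revert u v w; decide
  have h1 : ∀ c : ℤ, Finset.Ico (min c (c + 1)) (max c (c + 1)) = {c} := fun c => by
    rw [min_eq_left (by omega), max_eq_right (by omega)]; ext s; simp only [Finset.mem_Ico, Finset.mem_singleton]; omega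
  have hA : ∀ G : ℤ → ZMod 2, ∑ s ∈ Finset.Ico (min 0 (a + 1)) (max 0 (a + 1)), G s = ∑ s ∈ Finset.Ico (min 0 a) (max 0 a), G s + G a :=
    fun G => by rw [sum_Ico_minmax_chasles G 0 a (a + 1), h1, Finset.sum_singleton]
  simp only [rectCount, CondBoxStub.odd_card_filter_iff, Finset.sum_product]
  rw [hA, hA, sum_Ico_minmax_chasles (fun t => if (![a, t] : Site 2) ∈ parSet S ω then (1 : ZMod 2) else 0) 0 b (b + 1), h1, Finset.sum_singleton]
  exact key _ _ _ _

/-- The plaquette bit of an `S`-column face reads the biased field. -/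
theorem mem_parSet_of_mem {S : Set ℤ} {ω : Ω} {k l : ℕ} {q : Fin k × Fin l} (hq : ((q.1 : ℕ) : ℤ) ∈ S) :
    site q ∈ parSet S ω ↔ site q ∈ ω.2.2.1 := by simp [parSet, hq]

/-- The plaquette bit of a face off the `S`-columns reads the fair field. -/
theorem mem_parSet_of_not_mem {S : Set ℤ} {ω : Ω} {k l : ℕ} {q : Fin k × Fin l} (hq : ((q.1 : ℕ) : ℤ) ∉ S) :
    site q ∈ parSet S ω ↔ site q ∈ ω.2.2.2.1 := by simp [parSet, hq]

/-- READOUT: on `{colours = c}` the column signs, row signs and inner plaquette bits are prescribed by `c` and `B 0`. -/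
theorem readout {S : Set ℤ} {ω : Ω} {c : Col m n} (hcol : ∀ q, (site q ∈ blackSet S ω ↔ c q = true)) :
    (∀ x : Fin (m + 1), (((x : ℕ) : ℤ) ∈ ω.1 ↔ (c (x, 0) ^^ decide ((0 : ℤ) ∈ ω.2.1)) = true)) ∧
    (∀ y : Fin (n + 1), (((y : ℕ) : ℤ) ∈ ω.2.1 ↔ ((c (0, y) ^^ c (0, 0)) ^^ decide ((0 : ℤ) ∈ ω.2.1)) = true)) ∧
    (∀ q : Fin m × Fin n, (site q ∈ parSet S ω ↔ fpar c q = true)) := by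
  have hcell : ∀ (x : Fin (m + 1)) (y : Fin (n + 1)),
      (Xor (((x : ℕ) : ℤ) ∈ ω.1) (Xor (((y : ℕ) : ℤ) ∈ ω.2.1) (Odd (rectCount S ω ((x : ℕ) : ℤ) ((y : ℕ) : ℤ)))) ↔ c (x, y) = true) :=
    fun x y => (mem_blackSet_iff S ω _ _).symm.trans (hcol (x, y))
  have hr0 : ∀ a : ℤ, ¬ Odd (rectCount S ω a 0) := fun a => by simp [rectCount]
  have hc0 : ∀ b : ℤ, ¬ Odd (rectCount S ω 0 b) := fun b => by simp [rectCount]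
  obtain ⟨g, hg⟩ : ∃ g : Bool, decide ((0 : ℤ) ∈ ω.2.1) = g := ⟨_, rfl⟩
  have hB0 : ((0 : ℤ) ∈ ω.2.1 ↔ g = true) := (CondBoxStub.decide_eq_bool_iff _ _).1 hg; rw [hg]
  have hA : ∀ x : Fin (m + 1), (((x : ℕ) : ℤ) ∈ ω.1 ↔ (c (x, 0) ^^ g) = true) := fun x => by
    have h := hcell x 0; have hr := hr0 ((x : ℕ) : ℤ)
    simp only [Fin.val_zero, Nat.cast_zero] at h
    revert h hr hB0; cases c (x, 0) <;> cases g <;> grind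
  refine ⟨hA, fun y => ?_, fun q => ?_⟩
  · have h := hcell 0 y; have hc := hc0 ((y : ℕ) : ℤ); have h00 := hA 0
    simp only [Fin.val_zero, Nat.cast_zero] at h h00
    revert h hc h00 hB0; cases c (0, y) <;> cases c (0, 0) <;> cases g <;> grind
  · obtain ⟨i, j⟩ := q
    have h00 := hcell i.castSucc j.castSucc; have h10 := hcell i.succ j.castSucc; have h01 := hcell i.castSucc j.succ; have h11 := hcell i.succ j.succ
    have hT := odd_rectCount_succ_succ S ω ((i : ℕ) : ℤ) ((j : ℕ) : ℤ)
    simp only [Fin.val_castSucc, Fin.val_succ, Nat.cast_add, Nat.cast_one] at h00 h10 h01 h11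
    simp only [fpar, site]; revert h00 h10 h01 h11 hT
    cases c (i.castSucc, j.castSucc) <;> cases c (i.succ, j.castSucc) <;> cases c (i.castSucc, j.succ) <;> cases c (i.succ, j.succ) <;> grind

/-- Bernoulli cylinder of a site field: prescribed states at the sites `e i`. -/
abbrev cylinder {V ι : Type*} (e : ι → V) (η : ι → Bool) : Set (Set V) := {T | ∀ i, (e i ∈ T ↔ η i = true)}

/-- Cylinders are measurable. -/
theorem measurableSet_cylinder {V ι : Type*} [Countable ι] (e : ι → V) (η : ι → Bool) : MeasurableSet (cylinder e η) :=
  measurableSet_setOf.2 (Measurable.forall fun _ => (measurable_set_mem _).iff measurable_const)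

/-- Cylinder probabilities of a fair site field. -/
theorem real_cylinder_half {V ι : Type*} [Fintype ι] {e : ι → V} (he : Function.Injective e) (η : ι → Bool) :
    (sitePercolation V half).real (cylinder e η) = (1 / 2) ^ Fintype.card ι := by
  rw [CondBoxStub.sitePercolation_real_cylinder half he η, ← Finset.card_univ, ← Finset.prod_const]
  exact Finset.prod_congr rfl fun i _ => by cases η i <;> norm_num

/-- The product cylinder of gauge bits with colours `c`, coins `κ` on the box and row sign `B 0 = g`. -/
def cyl (S : Set ℤ) (c κ : Col m n) (g : Bool) : Set Ω :=
  cylinder (fun x : Fin (m + 1) => ((x : ℕ) : ℤ)) (fun x => c (x, 0) ^^ g) ×ˢ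
    (cylinder (fun y : Fin (n + 1) => ((y : ℕ) : ℤ)) (fun y => (c (0, y) ^^ c (0, 0)) ^^ g) ×ˢ
      (cylinder (fun q : {q : Fin m × Fin n // ((q.1 : ℕ) : ℤ) ∈ S} => site q.1) (fun q => fpar c q.1) ×ˢ
        (cylinder (fun q : {q : Fin m × Fin n // ((q.1 : ℕ) : ℤ) ∉ S} => site q.1) (fun q => fpar c q.1) ×ˢ
          cylinder (site : Fin (m + 1) × Fin (n + 1) → Site 2) κ)))

/-- `{colours = c, coins = κ} ⊆ ⋃_g cyl g`: the readout, field by field. -/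
theorem mem_cyl_of_eq {S : Set ℤ} {ω : Ω} {c κ : Col m n} (h : gaugeBox S (m + 1) (n + 1) ω = (c, κ)) :
    ω ∈ cyl S c κ (decide ((0 : ℤ) ∈ ω.2.1)) := by
  simp only [gaugeBox, Prod.mk.injEq, funext_iff, CondBoxStub.decide_eq_bool_iff] at h
  obtain ⟨hA, hB, hF⟩ := readout (S := S) (ω := ω) (c := c) h.1
  exact ⟨hA, hB, fun q => (mem_parSet_of_mem q.2).symm.trans (hF q.1), fun q => (mem_parSet_of_not_mem q.2).symm.trans (hF q.1), h.2⟩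

/-- `⋃_g cyl g ⊆ {colours = c, coins = κ}`: a configuration of the cylinder reads out a colouring with the same first row, first column
and face parities as `c`. -/
theorem eq_of_mem_cyl {S : Set ℤ} {ω : Ω} {c κ : Col m n} {g : Bool} (h : ω ∈ cyl S c κ g) : gaugeBox S (m + 1) (n + 1) ω = (c, κ) := by
  obtain ⟨hA, hB, hPb, hPf, hC⟩ := h
  obtain ⟨c', hc'⟩ : ∃ c' : Col m n, ∀ q, (site q ∈ blackSet S ω ↔ c' q = true) :=
    ⟨fun q => decide (site q ∈ blackSet S ω), fun q => by simp⟩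
  obtain ⟨hA', hB', hF'⟩ := readout hc'
  rw [show decide ((0 : ℤ) ∈ ω.2.1) = g from (CondBoxStub.decide_eq_bool_iff _ _).2 (by simpa using hB 0)] at hA' hB'
  have h0 : ∀ x, c (x, 0) = c' (x, 0) := fun x => by
    have e : ((c (x, 0) ^^ g) = true ↔ (c' (x, 0) ^^ g) = true) := (hA x).symm.trans (hA' x)
    revert e; cases c (x, 0) <;> cases c' (x, 0) <;> cases g <;> decide
  have h1 : ∀ y, c (0, y) = c' (0, y) := fun y => by
    have e : (((c (0, y) ^^ c (0, 0)) ^^ g) = true ↔ ((c' (0, y) ^^ c' (0, 0)) ^^ g) = true) := (hB y).symm.trans (hB' y)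
    rw [h0 0] at e; revert e; cases c (0, y) <;> cases c' (0, y) <;> cases c' (0, 0) <;> cases g <;> decide
  have hf : ∀ q, fpar c q = fpar c' q := fun q => Bool.eq_iff_iff.2 <| by
    by_cases hq : ((q.1 : ℕ) : ℤ) ∈ S
    · exact (hPb ⟨q, hq⟩).symm.trans ((mem_parSet_of_mem hq).symm.trans (hF' q))
    · exact (hPf ⟨q, hq⟩).symm.trans ((mem_parSet_of_not_mem hq).symm.trans (hF' q))
  obtain rfl := eq_of_fpar_eq h0 h1 hf
  simp only [gaugeBox, Prod.mk.injEq]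
  exact ⟨funext fun q => (CondBoxStub.decide_eq_bool_iff _ _).2 (hc' q), funext fun q => (CondBoxStub.decide_eq_bool_iff _ _).2 (hC q)⟩

/-- The event `{colours = c, coins = κ}` of the gauge is the union of the two product cylinders. -/
theorem preimage_gaugeBox (S : Set ℤ) (c κ : Col m n) : gaugeBox S (m + 1) (n + 1) ⁻¹' {(c, κ)} = cyl S c κ false ∪ cyl S c κ true := by
  ext ω
  simp only [Set.mem_preimage, Set.mem_singleton_iff, Set.mem_union]
  refine ⟨fun h => ?_, fun h => h.elim eq_of_mem_cyl eq_of_mem_cyl⟩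
  have h' := mem_cyl_of_eq h; revert h'; cases decide ((0 : ℤ) ∈ ω.2.1); exacts [fun h' => Or.inl h', fun h' => Or.inr h']

/-- `p = (1 − p)·t` (`p = pDef = 2√3 − 3`, `t = √3/2`): the product of the biased face factors is `(1 − p)^{N_S} · wt`. -/
theorem prod_bias (S : Set ℤ) (c : Col m n) : (∏ q : {q : Fin m × Fin n // ((q.1 : ℕ) : ℤ) ∈ S}, (if fpar c q.1 then (pDef : ℝ) else 1 - pDef)) =
    (1 - (pDef : ℝ)) ^ Fintype.card {q : Fin m × Fin n // ((q.1 : ℕ) : ℤ) ∈ S} * wt S c := by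
  have hp : (pDef : ℝ) = (1 - pDef) * ((tIK : ℝ≥0) : ℝ) := by
    rw [coe_pDef, coe_tIK]; linear_combination Real.mul_self_sqrt (show (0 : ℝ) ≤ 3 by norm_num)
  rw [Finset.prod_congr rfl fun q _ => show (if fpar c q.1 then (pDef : ℝ) else 1 - pDef) = (1 - pDef) * (if fpar c q.1 then ((tIK : ℝ≥0) : ℝ) else 1)
      by split_ifs; exacts [hp, by ring], Finset.prod_mul_distrib, Finset.prod_const, Finset.card_univ]
  congr 1
  rw [wt, ← Finset.prod_subtype (Finset.univ.filter fun q : Fin m × Fin n => ((q.1 : ℕ) : ℤ) ∈ S) (by simp)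
    (fun q : Fin m × Fin n => if fpar c q = true then ((tIK : ℝ≥0) : ℝ) else 1), Finset.prod_filter]
  exact Finset.prod_congr rfl fun q _ => by rw [ite_and]

/-- Mass of a product cylinder: the five fields are independent; the signs, the off-`S` faces and the coins are fair. -/
theorem real_cyl (S : Set ℤ) (c κ : Col m n) (g : Bool) : μIK.real (cyl S c κ g) = (1 / 2) ^ (m + 1) * ((1 / 2) ^ (n + 1) *
    ((1 - (pDef : ℝ)) ^ Fintype.card {q : Fin m × Fin n // ((q.1 : ℕ) : ℤ) ∈ S} * wt S c *
      ((1 / 2) ^ Fintype.card {q : Fin m × Fin n // ((q.1 : ℕ) : ℤ) ∉ S} * (1 / 2) ^ ((m + 1) * (n + 1))))) := by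
  have hinj : ∀ k, Function.Injective (fun x : Fin k => ((x : ℕ) : ℤ)) := fun k a b h => Fin.ext (by simpa using h)
  have hS : Function.Injective (fun q : {q : Fin m × Fin n // ((q.1 : ℕ) : ℤ) ∈ S} => site q.1) := fun a b h => Subtype.ext (site_injective h)
  have hT : Function.Injective (fun q : {q : Fin m × Fin n // ((q.1 : ℕ) : ℤ) ∉ S} => site q.1) := fun a b h => Subtype.ext (site_injective h)
  unfold μIK cyl
  rw [show Set.projIcc (0 : ℝ) 1 zero_le_one (2 * Real.sqrt 3 - 3) = pDef from rfl]
  rw [measureReal_prod_prod, measureReal_prod_prod, measureReal_prod_prod, measureReal_prod_prod, real_cylinder_half (hinj (m + 1)),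
    real_cylinder_half (hinj (n + 1)), CondBoxStub.sitePercolation_real_cylinder _ hS, real_cylinder_half hT, real_cylinder_half site_injective,
    prod_bias S c]
  simp only [Fintype.card_fin, Fintype.card_prod]

/-- `decide` of a measurable predicate is measurable (any decidability instances). -/
theorem measurable_decide {α : Type*} [MeasurableSpace α] {p : α → Prop} {d : ∀ a, Decidable (p a)} (hp : Measurable p) :
    Measurable fun a => @decide (p a) (d a) :=
  measurable_to_bool (by rw [show (fun a => @decide (p a) (d a)) ⁻¹' {true} = {a | p a} from Set.ext fun a => by simp]; exact measurableSet_setOf.2 hp)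

/-- `gaugeBox` is measurable. -/
theorem measurable_gaugeBox (S : Set ℤ) (W H : ℕ) : Measurable (gaugeBox S W H) :=
  (measurable_pi_lambda _ fun _ => measurable_decide (measurable_mem_blackSet S _)).prodMk
    (measurable_pi_lambda _ fun _ => measurable_decide ((measurable_set_mem _).comp measurable_snd.snd.snd.snd))

/-- THE GAUGE ATOM: `μIK{colours = c, coins = κ} = K_g · wt S c` (the two cylinders are disjoint: they differ at `B 0`). -/
theorem gauge_atom (S : Set ℤ) (c κ : Col m n) : (μIK.map (gaugeBox S (m + 1) (n + 1))).real {(c, κ)} =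
    2 * ((1 / 2) ^ (m + 1) * (1 / 2) ^ (n + 1) * (1 - (pDef : ℝ)) ^ Fintype.card {q : Fin m × Fin n // ((q.1 : ℕ) : ℤ) ∈ S} *
      (1 / 2) ^ Fintype.card {q : Fin m × Fin n // ((q.1 : ℕ) : ℤ) ∉ S} * (1 / 2) ^ ((m + 1) * (n + 1))) * wt S c := by
  haveI := isProbabilityMeasure_μIK
  have hm : MeasurableSet (cyl S c κ true) := (measurableSet_cylinder _ _).prod ((measurableSet_cylinder _ _).prod ((measurableSet_cylinder _ _).prod
    ((measurableSet_cylinder _ _).prod (measurableSet_cylinder _ _))))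
  have hd : Disjoint (cyl S c κ false) (cyl S c κ true) := Set.disjoint_left.2 fun ω h h' => by
    have h0 := h.2.1 0; have h1 := h'.2.1 0
    simp only [Fin.val_zero, Nat.cast_zero, Bool.xor_self, Bool.false_xor, Bool.false_eq_true, iff_false, iff_true] at h0 h1; exact h0 h1
  rw [map_measureReal_apply (measurable_gaugeBox S _ _) (measurableSet_singleton _), preimage_gaugeBox, measureReal_union hd hm, real_cyl, real_cyl]
  ring

/-- Configurations on `ℤ²` with prescribed values at the cells of the box. -/
def evalCyl (c : Col m n) : Set (Site 2 → Bool) := {σ | ∀ q, σ (site q) = c q}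

/-- The event `{colours = c, coins = κ}` of the free model is a product. -/
theorem preimage_freeBox (c κ : Col m n) : freeBox (m + 1) (n + 1) ⁻¹' {(c, κ)} = evalCyl c ×ˢ evalCyl κ := by
  ext x; simp only [Set.mem_preimage, Set.mem_singleton_iff, freeBox, Prod.mk.injEq, funext_iff, Set.mem_prod, evalCyl, Set.mem_setOf_eq, site]

/-- The black set of the box colouring `c`. -/
def blacks (c : Col m n) : Finset (Site 2) := (Finset.univ.filter fun q => c q = true).map ⟨site, site_injective⟩

/-- The black set lies in the box. -/
theorem blacks_subset (c : Col m n) : blacks c ⊆ cellRect 0 0 (m + 1) (n + 1) := fun v hv => by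
  obtain ⟨q, -, rfl⟩ := Finset.mem_map.1 hv
  exact site_mem_cellRect q

/-- Membership of a cell in the black set. -/
theorem site_mem_blacks {c : Col m n} {q : Fin (m + 1) × Fin (n + 1)} : site q ∈ blacks c ↔ c q = true := by
  simp only [blacks, Finset.mem_map, Finset.mem_filter, Finset.mem_univ, true_and, Function.Embedding.coeFn_mk, site_injective.eq_iff, exists_eq_right]

/-- The colouring of `ℤ²` equal to `c` on the box and white outside. -/
def ext (c : Col m n) : Site 2 → Bool := boxFill (cellRect 0 0 (m + 1) (n + 1)) (fun _ => false) (blacks c)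

/-- `ext c` is `c` on the box. -/
theorem ext_site (c : Col m n) (q : Fin (m + 1) × Fin (n + 1)) : ext c (site q) = c q := by
  rw [ext, boxFill_apply_of_mem _ _ (site_mem_cellRect q), CondBoxStub.decide_eq_bool_iff]
  exact site_mem_blacks

/-- THE COLOUR ATOM of the free model: only the filling `ext c` is compatible, `P = Z⁻¹ t^{#odd S-faces}`. -/
theorem colourLaw_atom (S : Set ℤ) (c : Col m n) : colourLaw S (cellRect 0 0 (m + 1) (n + 1)) (evalCyl c) =
    (cornerPartitionFunction tIK (facesIn S (cellRect 0 0 (m + 1) (n + 1))) (cellRect 0 0 (m + 1) (n + 1)) fun _ => false)⁻¹ *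
      cornerWeight tIK (facesIn S (cellRect 0 0 (m + 1) (n + 1))) (ext c) := by
  rw [colourLaw, cornerGibbsMeasure_apply]
  congr 1
  rw [Finset.sum_eq_single_of_mem (blacks c) (Finset.mem_powerset.2 (blacks_subset c))]
  · show (evalCyl c).indicator _ (ext c) = _
    rw [Set.indicator_of_mem (show ext c ∈ evalCyl c from fun q => ext_site c q)]
  · intro s hs hne
    refine Set.indicator_of_notMem (fun h => hne ?_) _
    ext v
    by_cases hv : v ∈ cellRect 0 0 (m + 1) (n + 1)
    · obtain ⟨h0, hk, h1, hl⟩ := mem_cellRect_iff.1 hv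
      obtain ⟨q, rfl⟩ := exists_site_eq h0 hk h1 hl
      have hq := h q
      rw [boxFill_apply_of_mem _ _ hv, CondBoxStub.decide_eq_bool_iff] at hq
      exact hq.trans site_mem_blacks.symm
    · exact ⟨fun h' => absurd (Finset.mem_powerset.1 hs h') hv, fun h' => absurd (blacks_subset c h') hv⟩

/-- The parity of `ext c` at an inner face is the face parity of `c`. -/
theorem isOddFace_site (c : Col m n) (q : Fin m × Fin n) : IsOddFace (ext c) (site q) ↔ fpar c q = true := by
  have e1 : site q = site (q.1.castSucc, q.2.castSucc) := Contour.site_ext (by simp) (by simp)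
  have e2 : site q + Pi.single 0 1 = site (q.1.succ, q.2.castSucc) := Contour.site_ext (by simp) (by simp)
  have e3 : site q + Pi.single 1 1 = site (q.1.castSucc, q.2.succ) := Contour.site_ext (by simp) (by simp)
  have e4 : site q + 1 = site (q.1.succ, q.2.succ) := Contour.site_ext (by simp) (by simp)
  rw [isOddFace_iff_xor, e2, e3, e4, e1, ext_site, ext_site, ext_site, ext_site, fpar]

/-- `t ^ #{odd S-faces of ext c} = wt S c` (the inner `S`-faces are the sites `site q`, `q.1 ∈ S`). -/
theorem pow_oddFaceCount (S : Set ℤ) (c : Col m n) : ((tIK : ℝ≥0) : ℝ) ^ oddFaceCount (facesIn S (cellRect 0 0 (m + 1) (n + 1))) (ext c) = wt S c := by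
  rw [wt, ← Finset.prod_filter, Finset.prod_const, oddFaceCount]
  congr 1
  rw [← Finset.card_map (s := Finset.univ.filter fun q : Fin m × Fin n => ((q.1 : ℕ) : ℤ) ∈ S ∧ fpar c q = true) ⟨site, site_injective⟩]
  congr 1
  ext v
  simp only [facesIn, Finset.mem_filter, Finset.mem_map, Finset.mem_univ, true_and, Function.Embedding.coeFn_mk]
  constructor
  · rintro ⟨⟨hv, hS⟩, hodd⟩; obtain ⟨q, rfl⟩ := mem_innerVertices_iff_site.1 hv; exact ⟨q, ⟨hS, (isOddFace_site c q).1 hodd⟩, rfl⟩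
  · rintro ⟨q, ⟨hS, hf⟩, rfl⟩; exact ⟨⟨mem_innerVertices_iff_site.2 ⟨q, rfl⟩, hS⟩, (isOddFace_site c q).2 hf⟩

/-- THE COIN ATOM of the free model: `(1/2)^{(m+1)(n+1)}`. -/
theorem coin_atom (κ : Col m n) : (coinMeasure half).real (evalCyl κ) = (1 / 2) ^ ((m + 1) * (n + 1)) := by
  have hset : evalCyl κ = Set.pi ↑((Finset.univ : Finset (Fin (m + 1) × Fin (n + 1))).map ⟨site, site_injective⟩)
      (fun v => {b : Bool | ∃ q, site q = v ∧ b = κ q}) := by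
    ext k
    simp only [evalCyl, Set.mem_setOf_eq, Set.mem_pi, Finset.coe_map, Finset.coe_univ, Set.image_univ, Set.mem_range, forall_exists_index,
      forall_apply_eq_imp_iff, Function.Embedding.coeFn_mk, site_injective.eq_iff, exists_eq_left]
  rw [hset, coinMeasure, measureReal_def, Measure.infinitePi_pi _ (fun _ _ => MeasurableSet.of_discrete), ENNReal.toReal_prod, Finset.prod_map,
    show (m + 1) * (n + 1) = (Finset.univ : Finset (Fin (m + 1) × Fin (n + 1))).card by simp, ← Finset.prod_const]
  refine Finset.prod_congr rfl fun q _ => ?_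
  have hs : {b : Bool | ∃ q', site q' = site q ∧ b = κ q'} = {κ q} := by ext b; simp [site_injective.eq_iff]
  show ((bernoulliMeasure true false half : Measure Bool) {b : Bool | ∃ q', site q' = site q ∧ b = κ q'}).toReal = 1 / 2
  rw [hs, ← measureReal_def]
  cases κ q <;> norm_num

/-- `freeBox` is measurable. -/
theorem measurable_freeBox (W H : ℕ) : Measurable (freeBox W H) :=
  (measurable_pi_lambda _ fun _ => (measurable_pi_apply _).comp measurable_fst).prodMk
    (measurable_pi_lambda _ fun _ => (measurable_pi_apply _).comp measurable_snd)

/-- THE FREE ATOM: `(boxLaw){colours = c, coins = κ} = K_f · wt S c`. -/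
theorem free_atom (S : Set ℤ) (c κ : Col m n) : ((boxLaw S (cellRect 0 0 (m + 1) (n + 1))).map (freeBox (m + 1) (n + 1))).real {(c, κ)} =
    (cornerPartitionFunction tIK (facesIn S (cellRect 0 0 (m + 1) (n + 1))) (cellRect 0 0 (m + 1) (n + 1)) fun _ => false).toReal⁻¹ *
      (1 / 2) ^ ((m + 1) * (n + 1)) * wt S c := by
  haveI : IsProbabilityMeasure (colourLaw S (cellRect 0 0 (m + 1) (n + 1))) := by unfold colourLaw; infer_instance
  rw [map_measureReal_apply (measurable_freeBox _ _) (measurableSet_singleton _), preimage_freeBox, boxLaw, measureReal_prod_prod, coin_atom,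
    measureReal_def, colourLaw_atom, ENNReal.toReal_mul, ENNReal.toReal_inv, cornerWeight, ENNReal.toReal_pow, ENNReal.coe_toReal, pow_oddFaceCount]
  ring

/-- Two probability measures on a finite type whose atoms are proportional to a common weight are equal (total mass fixes the constants). -/
theorem measure_eq_of_proportional {α : Type*} [MeasurableSpace α] [Fintype α] [MeasurableSingletonClass α] {μ ν : Measure α} [IsProbabilityMeasure μ]
    [IsProbabilityMeasure ν] (w : α → ℝ) (a b : ℝ) (hμ : ∀ x, μ.real {x} = a * w x) (hν : ∀ x, ν.real {x} = b * w x) : μ = ν := by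
  have tot : ∀ (ρ : Measure α) [IsProbabilityMeasure ρ] (k : ℝ), (∀ x, ρ.real {x} = k * w x) → k * ∑ x, w x = 1 := fun ρ _ k hk => by
    rw [Finset.mul_sum, ← Finset.sum_congr rfl fun x _ => hk x, sum_measureReal_singleton, Finset.coe_univ, probReal_univ]
  have ha := tot μ a hμ
  have hs : ∑ x, w x ≠ 0 := fun h => zero_ne_one (by rw [h, mul_zero] at ha; exact ha)
  exact Measure.ext_of_measureReal_singleton fun x => by rw [hμ, hν, mul_right_cancel₀ hs (ha.trans (tot ν b hν).symm)]

/-- Probability measures on a one-point type are equal. -/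
theorem eq_of_subsingleton {α : Type*} [MeasurableSpace α] [Subsingleton α] (μ ν : Measure α) [IsProbabilityMeasure μ] [IsProbabilityMeasure ν] :
    μ = ν :=
  Measure.ext fun s _ => Subsingleton.set_cases (p := fun s => μ s = ν s) (by simp) (by simp) s

end BridgeLawStub

open BridgeLawStub in
/-- **Registered stub `stub_bridgeLaw`** (line `defect-closure-exploration`): at the origin the gauge's box marginal (colours of
`[0, W) × [0, H)` and the coins there, under `μIK`) IS the finite free mixed model `boxLaw S (cellRect 0 0 W H)` read on the box. -/
theorem stub_bridgeLaw : BridgeLaw := by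
  intro S W H
  haveI := isProbabilityMeasure_μIK
  haveI : IsProbabilityMeasure (boxLaw S (cellRect 0 0 W H)) := by unfold boxLaw colourLaw; infer_instance
  haveI := Measure.isProbabilityMeasure_map (μ := μIK) (measurable_gaugeBox S W H).aemeasurable
  haveI := Measure.isProbabilityMeasure_map (μ := boxLaw S (cellRect 0 0 W H)) (measurable_freeBox W H).aemeasurable
  obtain _ | m := W; · exact eq_of_subsingleton _ _
  obtain _ | n := H; · exact eq_of_subsingleton _ _
  exact measure_eq_of_proportional (fun d : BoxData (m + 1) (n + 1) => wt S d.1) _ _ (fun d => gauge_atom S d.1 d.2) (fun d => free_atom S d.1 d.2)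

end Summit.CriticalPhenomena.CardyFormulaZ2.Cruxes.IKMixedBoxCrossing.DefectClosureExploration

end
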